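import Literature.MathematicalPhysics.QuantumFieldTheory.Balaban1983to89.B9Thm31SiteGpKernelTorusDecayReg335Y

/-!
# `Balaban1983to89.B9Thm31SiteGpSetTorusDecayReg335Y` — T. Bałaban, *Propagators for lattice gauge theories in a background field*, Commun. Math. Phys. **99**
# (1985) 389–434 [Balaban1985BackgroundPropagators] Thm 3.1 (3.46) p. 398, by S. Agmon's method [Agmon1982]: ★★★ **THE HYPOTHESIS-FREE SET-TO-SET DECAY OF
# def-Y's `G′(U)` ON THE (3.35) CLASS** — for finite site sets `A`, `B` at torus sup-distance `≥ L^k·r` and `Ψ` supported in `B`: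
# `Σ_{z∈A} HS((G′(U)Ψ)(z)) ≤ 256·(L^{j_A})²(L^{j_B})²·e^{−2δ₀r}·‖Ψ‖²₁` — print's (3.46a) `‖hG′(U)λ‖ ≤ B₀(Lʲη)(Lʲ′η)e^{−δ₀d}‖h‖‖λ‖` with the coarsest-scale distance,
# NO weight hypothesis left (file 19 of the site-coercivity set of width seat `pub-ymgap-dag-n06-w1`)

statement-level skeleton of published theorems with citation tags; proofs where landed; nothing here is a claim about the Yang–Mills mass gap

THE PRINT (p. 398).  (3.46): *«‖hG′(U)λ‖ … ≤ B₀(Lʲη)(Lʲ′η)e^{−δ₀d(y,y′)}‖h‖‖λ‖ for supp h ⊂ Δ̃(y), y ∈ Λ_j, supp λ ⊂ Δ̃(y′)»*.  File 15 exhibited the admissible exponent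
`(L^k)⁻¹|· − y|_T` for a ONE-SITE source; for a source SET `B` the exponent is the torus sup-distance TO THE SET, `ρ_B(z) := (L^k)⁻¹·min_{y∈B}|z − y|_T` (a minimum of
`(L^k)⁻¹`-Lipschitz functions), which vanishes on `B`; file 7's `hs_restrict_GpY_parSymY_le_exp_canonical` then reads as the block-to-block ∕ set-to-set bound above.

WHAT IS PROVED (sorry-free; 0 `def`; nothing of [B9] asserted beyond what is proved).
* §1 `abs_inf'_sub_inf'_le` (minima of functions that differ pointwise by `≤ c` differ by `≤ c`), `torusSetAgmon_bond ∕ _bond' ∕ _block ∕ _zero_of_mem ∕ _ge`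
  (`ρ_B` is admissible: bond steps `≤ (L^k)⁻¹ ≤ (L^{lev})⁻¹`, block oscillation `< 1 ≤ d+1`, `ρ_B = 0` on `B`, `ρ_B ≥ r` on `A` when `L^k·r ≤ |z − y|_T` for `z ∈ A`, `y ∈ B`).
* §2 ★★★ **`hs_restrict_GpY_le_torus`**: `G ≤ U(N)`, `N ≥ 1`, `0 ≤ c·M·α₀`, `c·M·α₀·(d+1) ≤ 1∕16`, `U ∈ Reg335 c α₀`; finite `A`, nonempty finite `B`, `Ψ` vanishing off `B`,
  levels `≤ j_A` on `A`, `≤ j_B` on `B`, and `r` with `L^k·r ≤ |z − y|_T` for all `z ∈ A`, `y ∈ B`: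
  `Σ_{z∈A} HS((G′(U)Ψ)(z)) ≤ 256·((L^{j_A})²(L^{j_B})²∕(e^{δ₀r})²)·‖Ψ‖²₁`, `δ₀ = 1∕(4(d+2))`.
MODEL ∕ DECLARED READINGS.  As file 15 (torus sup-distance of NODE 00's box, coarsest scale `L^k`); with `A`, `B` = blocks of `𝔅` this is a block-`L²` operator bound
`‖1_AG′(U)1_B‖ ≤ 16L^{j_A}L^{j_B}e^{−δ₀·dist_T(A,B)∕L^k}` — the SHAPE of the cell's `BlockBd` currency with an explicit `N(a,b)`.  RATE NOTE (numbers, not adjectives): the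
rate here is `δ₀∕L^k` per unit of torus distance — `k`-DEPENDENT (coarsest scale); the `k`-UNIFORM reading with print's multiscale block distance `d(y,y′)` of [4] (2.46)
is dag-n06-j's `B9Thm31SiteAgmonExponentY.hs_restrict_GpY_parSymY_le_distT ∕ hs_GpY_deltaY_le_distT` (exponent `msRhoT`, source in ONE block); the present file is the
complementary statement for ARBITRARY site sets `A`, `B` (not block-aligned) with the elementary exponent `min_{y∈B}|· − y|_T∕L^k`.  HONEST SCOPE.  A decay estimate
for one finite lattice operator; NOT a node discharge, NOT summit progress; count-neutral; nothing continuum ∕ OS ∕ mass gap ∕ Clay.  NEW file importing file 15 only.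
-/

noncomputable section

namespace Literature.MathematicalPhysics.QuantumFieldTheory.Balaban1983to89.B9Thm31SiteGpSetTorusDecayReg335Y

open Literature.MathematicalPhysics.QuantumFieldTheory.Balaban1983to89
open Node00 B6KLevelCensusIndexV1 B6Geom246MultiLevelBox B6MultiLevelBoxOperator B6MultiLevelTorusOperator B6GlobalChartV1 B9BackgroundsKLevelV1
  B9Eq39Adjoint B9Thm311ReadingCoords B9Thm311DeltaPrimePos B9Ineq369CurvatureSmallAtLettersY B9Thm31SiteCoerciveGaugeBlockY
  B9Thm31SiteCoerciveReg335Y B9Thm31SiteGpBoundsReg335Y B9Thm31SitePolarisedFormY B9Thm31SiteConjugatedFormY B9Thm31SiteGpDecayReg335Y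
  B9Thm31SiteAgmonWeightY B9Thm31SiteGpWeightedReg335Y B9Thm31SiteGpKernelTorusDecayReg335Y
open Literature.MathematicalPhysics.QuantumFieldTheory.Balaban1983to89.B4TorusKernel.MultiPeriod (torusSupNorm torusSupNorm_nonneg)
open Literature.MathematicalPhysics.QuantumFieldTheory.Balaban1983to89.B6MemberOfCubeV1 (torusSupNorm_sub_le)
open Literature.MathematicalPhysics.QuantumFieldTheory.Balaban1983to89.B6Cov2110WeightV1 (torusSupNorm_zero)
open scoped Matrix Matrix.Norms.L2Operator

/-! ## §1 The torus distance to a set is an admissible Agmon exponent -/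

section Inf

/-- minima of two families that differ pointwise by at most `c` differ by at most `c`. [folklore] -/
private theorem abs_inf'_sub_inf'_le {ι : Type} {B : Finset ι} (hB : B.Nonempty) (f g : ι → ℝ) {c : ℝ} (h : ∀ y ∈ B, |f y - g y| ≤ c) :
    |B.inf' hB f - B.inf' hB g| ≤ c := by
  rw [abs_le]
  constructor
  · -- `inf g ≤ g y₀` at the minimiser `y₀` of `f`: `inf f = f y₀ ≥ g y₀ − c ≥ inf g − c`
    obtain ⟨y₀, hy₀, hfy₀⟩ := Finset.exists_mem_eq_inf' hB f
    have hg : B.inf' hB g ≤ g y₀ := Finset.inf'_le g hy₀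
    have hc := (abs_le.1 (h y₀ hy₀)).1
    rw [hfy₀]; linarith
  · obtain ⟨y₀, hy₀, hgy₀⟩ := Finset.exists_mem_eq_inf' hB g
    have hf : B.inf' hB f ≤ f y₀ := Finset.inf'_le f hy₀
    have hc := (abs_le.1 (h y₀ hy₀)).2
    rw [hgy₀]; linarith

end Inf

section Weight

variable {d ℓ : ℕ} {hd : 1 ≤ d + 1} {hL : Odd (ℓ + 1) ∧ 1 < ℓ + 1} {b₀ b₁ : ℝ}
variable (i : KIdx d ℓ hd hL b₀ b₁)

/-- ★ BOND STEPS of `ρ_B = (L^k)⁻¹·min_{y∈B}|· − y|_T` (source end). [cite: Agmon1982, Ch.1; Balaban1984PropagatorsII, (2.1)–(2.4) p.224] -/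
theorem torusSetAgmon_bond {B : Finset (SiteY i)} (hB : B.Nonempty) (μ : Fin (d + 1)) (z : SiteY i) :
    |((((ℓ + 1) ^ i.k : ℕ) : ℝ))⁻¹ * B.inf' hB (fun y => torusSupNorm (toKT i).NB ((shiftY i μ z).1 - y.1))
        - ((((ℓ + 1) ^ i.k : ℕ) : ℝ))⁻¹ * B.inf' hB (fun y => torusSupNorm (toKT i).NB (z.1 - y.1))|
      ≤ ((((ℓ + 1) ^ (blkOf i.D.toDomains z).1.1 : ℕ) : ℝ))⁻¹ := by
  have hk : (0 : ℝ) < (((ℓ + 1) ^ i.k : ℕ) : ℝ) := by positivity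
  rw [← mul_sub, abs_mul, abs_of_pos (inv_pos.2 hk)]
  have h := abs_inf'_sub_inf'_le hB (fun y => torusSupNorm (toKT i).NB ((shiftY i μ z).1 - y.1)) (fun y => torusSupNorm (toKT i).NB (z.1 - y.1))
    (fun y _ => abs_torusSupNorm_shift_sub_le i μ z y)
  have hpow : (((ℓ + 1) ^ (blkOf i.D.toDomains z).1.1 : ℕ) : ℝ) ≤ (((ℓ + 1) ^ i.k : ℕ) : ℝ) := by
    exact_mod_cast Nat.pow_le_pow_right (Nat.succ_pos ℓ) (B9GeoNormsKLevelV1.blkOf_level_le i z)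
  calc ((((ℓ + 1) ^ i.k : ℕ) : ℝ))⁻¹ * |B.inf' hB (fun y => torusSupNorm (toKT i).NB ((shiftY i μ z).1 - y.1)) - B.inf' hB (fun y => torusSupNorm (toKT i).NB (z.1 - y.1))|
      ≤ ((((ℓ + 1) ^ i.k : ℕ) : ℝ))⁻¹ * 1 := mul_le_mul_of_nonneg_left h (inv_nonneg.2 hk.le)
    _ ≤ _ := by rw [mul_one]; exact inv_anti₀ (by positivity) hpow

/-- ★ BOND STEPS (target end). [cite: Agmon1982, Ch.1; Balaban1984PropagatorsII, (2.1)–(2.4) p.224] -/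
theorem torusSetAgmon_bond' {B : Finset (SiteY i)} (hB : B.Nonempty) (μ : Fin (d + 1)) (z : SiteY i) :
    |((((ℓ + 1) ^ i.k : ℕ) : ℝ))⁻¹ * B.inf' hB (fun y => torusSupNorm (toKT i).NB ((shiftY i μ z).1 - y.1))
        - ((((ℓ + 1) ^ i.k : ℕ) : ℝ))⁻¹ * B.inf' hB (fun y => torusSupNorm (toKT i).NB (z.1 - y.1))|
      ≤ ((((ℓ + 1) ^ (blkOf i.D.toDomains (shiftY i μ z)).1.1 : ℕ) : ℝ))⁻¹ := by
  have hk : (0 : ℝ) < (((ℓ + 1) ^ i.k : ℕ) : ℝ) := by positivity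
  rw [← mul_sub, abs_mul, abs_of_pos (inv_pos.2 hk)]
  have h := abs_inf'_sub_inf'_le hB (fun y => torusSupNorm (toKT i).NB ((shiftY i μ z).1 - y.1)) (fun y => torusSupNorm (toKT i).NB (z.1 - y.1))
    (fun y _ => abs_torusSupNorm_shift_sub_le i μ z y)
  have hpow : (((ℓ + 1) ^ (blkOf i.D.toDomains (shiftY i μ z)).1.1 : ℕ) : ℝ) ≤ (((ℓ + 1) ^ i.k : ℕ) : ℝ) := by
    exact_mod_cast Nat.pow_le_pow_right (Nat.succ_pos ℓ) (B9GeoNormsKLevelV1.blkOf_level_le i (shiftY i μ z))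
  calc ((((ℓ + 1) ^ i.k : ℕ) : ℝ))⁻¹ * |B.inf' hB (fun y => torusSupNorm (toKT i).NB ((shiftY i μ z).1 - y.1)) - B.inf' hB (fun y => torusSupNorm (toKT i).NB (z.1 - y.1))|
      ≤ ((((ℓ + 1) ^ i.k : ℕ) : ℝ))⁻¹ * 1 := mul_le_mul_of_nonneg_left h (inv_nonneg.2 hk.le)
    _ ≤ _ := by rw [mul_one]; exact inv_anti₀ (by positivity) hpow

/-- ★ BLOCK OSCILLATION of `ρ_B`: `< 1 ≤ d+1` on every block of `𝔅`. [cite: Agmon1982, Ch.1; Balaban1984PropagatorsII, (2.3)–(2.4) p.224] -/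
theorem torusSetAgmon_block {B : Finset (SiteY i)} (hB : B.Nonempty) (z w : SiteY i) (h : blkOf i.D.toDomains w = blkOf i.D.toDomains z) :
    |((((ℓ + 1) ^ i.k : ℕ) : ℝ))⁻¹ * B.inf' hB (fun y => torusSupNorm (toKT i).NB (z.1 - y.1))
        - ((((ℓ + 1) ^ i.k : ℕ) : ℝ))⁻¹ * B.inf' hB (fun y => torusSupNorm (toKT i).NB (w.1 - y.1))| ≤ (d : ℝ) + 1 := by
  have hN1 := one_le_NB i z
  have hk : (0 : ℝ) < (((ℓ + 1) ^ i.k : ℕ) : ℝ) := by positivity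
  rw [← mul_sub, abs_mul, abs_of_pos (inv_pos.2 hk)]
  have hzw := torusSupNorm_sub_le_of_blkOf_eq i h
  have hwz : torusSupNorm (toKT i).NB (w.1 - z.1) ≤ (((ℓ + 1) ^ (blkOf i.D.toDomains z).1.1 : ℕ) : ℝ) - 1 := by
    rw [show w.1 - z.1 = -(z.1 - w.1) by abel, B6Geom246MultiLevelTorus.torusSupNorm_neg hN1]; exact hzw
  -- pointwise `| |z−y|_T − |w−y|_T | ≤ |z−w|_T`
  have hpt : ∀ y ∈ B, |torusSupNorm (toKT i).NB (z.1 - y.1) - torusSupNorm (toKT i).NB (w.1 - y.1)| ≤ (((ℓ + 1) ^ (blkOf i.D.toDomains z).1.1 : ℕ) : ℝ) - 1 := by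
    intro y _
    have h1 := torusSupNorm_sub_le hN1 z.1 w.1 y.1
    have h2 := torusSupNorm_sub_le hN1 w.1 z.1 y.1
    rw [abs_le]; constructor <;> linarith
  have h := abs_inf'_sub_inf'_le hB (fun y => torusSupNorm (toKT i).NB (z.1 - y.1)) (fun y => torusSupNorm (toKT i).NB (w.1 - y.1)) hpt
  have hpow : (((ℓ + 1) ^ (blkOf i.D.toDomains z).1.1 : ℕ) : ℝ) ≤ (((ℓ + 1) ^ i.k : ℕ) : ℝ) := by
    exact_mod_cast Nat.pow_le_pow_right (Nat.succ_pos ℓ) (B9GeoNormsKLevelV1.blkOf_level_le i z)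
  have hd0 : (0 : ℝ) ≤ d := Nat.cast_nonneg d
  calc ((((ℓ + 1) ^ i.k : ℕ) : ℝ))⁻¹ * |B.inf' hB (fun y => torusSupNorm (toKT i).NB (z.1 - y.1)) - B.inf' hB (fun y => torusSupNorm (toKT i).NB (w.1 - y.1))|
      ≤ ((((ℓ + 1) ^ i.k : ℕ) : ℝ))⁻¹ * (((ℓ + 1) ^ i.k : ℕ) : ℝ) := mul_le_mul_of_nonneg_left (h.trans (by linarith)) (inv_nonneg.2 hk.le)
    _ = 1 := inv_mul_cancel₀ hk.ne'
    _ ≤ (d : ℝ) + 1 := by linarith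

/-- `ρ_B = 0` on `B`. [cite: Agmon1982, Ch.1, bookkeeping] -/
theorem torusSetAgmon_zero_of_mem {B : Finset (SiteY i)} (hB : B.Nonempty) {z : SiteY i} (hz : z ∈ B) :
    ((((ℓ + 1) ^ i.k : ℕ) : ℝ))⁻¹ * B.inf' hB (fun y => torusSupNorm (toKT i).NB (z.1 - y.1)) = 0 := by
  have hle : B.inf' hB (fun y => torusSupNorm (toKT i).NB (z.1 - y.1)) ≤ 0 := by
    have h := Finset.inf'_le (fun y => torusSupNorm (toKT i).NB (z.1 - y.1)) hz
    simp only [sub_self, torusSupNorm_zero] at h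
    exact h
  have hN1 := one_le_NB i z
  have hge : 0 ≤ B.inf' hB (fun y => torusSupNorm (toKT i).NB (z.1 - y.1)) :=
    (Finset.le_inf'_iff hB _).2 fun y _ => torusSupNorm_nonneg hN1 _
  rw [le_antisymm hle hge, mul_zero]

/-- `ρ_B ≥ r` on `A` when `L^k·r ≤ |z − y|_T` for all `z ∈ A`, `y ∈ B`. [cite: Agmon1982, Ch.1, bookkeeping] -/
theorem torusSetAgmon_ge {A B : Finset (SiteY i)} (hB : B.Nonempty) {r : ℝ}
    (hr : ∀ z ∈ A, ∀ y ∈ B, (((ℓ + 1) ^ i.k : ℕ) : ℝ) * r ≤ torusSupNorm (toKT i).NB (z.1 - y.1)) (z : SiteY i) (hz : z ∈ A) :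
    r ≤ ((((ℓ + 1) ^ i.k : ℕ) : ℝ))⁻¹ * B.inf' hB (fun y => torusSupNorm (toKT i).NB (z.1 - y.1)) := by
  have hk : (0 : ℝ) < (((ℓ + 1) ^ i.k : ℕ) : ℝ) := by positivity
  have h : (((ℓ + 1) ^ i.k : ℕ) : ℝ) * r ≤ B.inf' hB (fun y => torusSupNorm (toKT i).NB (z.1 - y.1)) :=
    (Finset.le_inf'_iff hB _).2 fun y hy => hr z hz y hy
  rw [le_inv_mul_iff₀ hk]
  exact h

end Weight

/-! ## §2 The hypothesis-free set-to-set decay -/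

section Main

variable {d ℓ : ℕ} {hd : 1 ≤ d + 1} {hL : Odd (ℓ + 1) ∧ 1 < ℓ + 1} {b₀ b₁ : ℝ}
variable (i : KIdx d ℓ hd hL b₀ b₁) {N : ℕ} {G : Subgroup (Matrix (Fin N) (Fin N) ℂ)ˣ}

/-- ★★★ **THE HYPOTHESIS-FREE SET-TO-SET DECAY OF `G′(U)` ON THE CLASS (3.35)**: `G ≤ U(N)`, `N ≥ 1`, `0 ≤ c·M·α₀`, `c·M·α₀·(d+1) ≤ 1∕16`, `U ∈ Reg335 c α₀`; finite site
sets `A`, `B` (`B` nonempty), `Ψ` vanishing off `B`, levels `≤ j_A` on `A` and `≤ j_B` on `B`, and `r` with `L^k·r ≤ |z − y|_T` for all `z ∈ A`, `y ∈ B`.  THEN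
`Σ_{z∈A} HS((G′(U)Ψ)(z)) ≤ 256·((L^{j_A})²(L^{j_B})²∕(e^{δ₀r})²)·‖Ψ‖²₁`, `δ₀ = 1∕(4(d+2))` — i.e. `‖1_AG′(U)1_B‖ ≤ 16·L^{j_A}L^{j_B}·e^{−δ₀·dist_T(A,B)∕L^k}`
(a `k`-DEPENDENT rate `δ₀∕L^k`; the `k`-uniform block-distance reading is `B9Thm31SiteAgmonExponentY.hs_restrict_GpY_parSymY_le_distT`).
[cite: Balaban1985BackgroundPropagators, Thm 3.1 (3.46) p.398, (3.35) p.396; Agmon1982, Ch.1, Thm 1.5] -/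
theorem hs_restrict_GpY_le_torus [Nonempty (Fin N)] (hG : G ≤ B7Prop2Explicit.unitaryUnits (Matrix (Fin N) (Fin N) ℂ))
    {U : CfgY (Matrix (Fin N) (Fin N) ℂ) i} {c α₀ : ℝ} (hC0 : 0 ≤ c * (kGeo i).M * α₀) (hC1 : c * (kGeo i).M * α₀ * ((d : ℝ) + 1) ≤ 1 / 16)
    (hreg : (bg9K (Matrix (Fin N) (Fin N) ℂ) G i).Reg335 c α₀ U) {A B : Finset (SiteY i)} (hB : B.Nonempty) {Ψ : SiteY i → Matrix (Fin N) (Fin N) ℂ}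
    (hΨ : ∀ z, z ∉ B → Ψ z = 0) {jA jB : ℕ} (hjA : ∀ z ∈ A, (blkOf i.D.toDomains z).1.1 ≤ jA) (hjB : ∀ z ∈ B, (blkOf i.D.toDomains z).1.1 ≤ jB)
    {r : ℝ} (hr : ∀ z ∈ A, ∀ y ∈ B, (((ℓ + 1) ^ i.k : ℕ) : ℝ) * r ≤ torusSupNorm (toKT i).NB (z.1 - y.1)) :
    ∑ z ∈ A, ∑ a, ∑ b, ‖GpY i (parSymY i) U Ψ z a b‖ ^ 2
      ≤ 256 * (((((ℓ + 1) ^ jA : ℕ) : ℝ)) ^ 2 * ((((ℓ + 1) ^ jB : ℕ) : ℝ)) ^ 2 / Real.exp ((1 / (4 * ((d : ℝ) + 2))) * r) ^ 2) * trIP (fun _ => (1 : ℝ)) Ψ Ψ :=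
  hs_restrict_GpY_parSymY_le_exp_canonical i hG hC0 hC1 hreg
    (ρ := fun z => ((((ℓ + 1) ^ i.k : ℕ) : ℝ))⁻¹ * B.inf' hB (fun y => torusSupNorm (toKT i).NB (z.1 - y.1)))
    (fun μ z => torusSetAgmon_bond i hB μ z) (fun μ z => torusSetAgmon_bond' i hB μ z) (fun z w h => torusSetAgmon_block i hB z w h) hΨ
    (fun _ hz => torusSetAgmon_zero_of_mem i hB hz) hjA hjB (fun z hz => torusSetAgmon_ge i hB hr z hz)

end Main

end Literature.MathematicalPhysics.QuantumFieldTheory.Balaban1983to89.B9Thm31SiteGpSetTorusDecayReg335Y
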